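/-
Origin: expansion seat `prover-pub-hodgecm-mc-sinst-1-g10-0`, handover #1248 2026-08-20T22:36Z md5 1535d9f21ed7 (151 l.; NEW additive leaf, ns HodgeCM.Model.ThetaAdelicSide.ThetaDistDatum: ωfV, ωfW, commute_ωfV_ωfW, coinvRep (Liu's module of the slot at χ), coinvRep_mk, distBar, distBar_mk, range_distBar, distBar_coinvRep, clsU_distU_mem_block, map_clsU_range_distU_le_block, exists_mem_holSatU_clsU_mem_block; imports #1247 + #1244; NAMES for audit: HodgeCM.Model.ThetaAdelicSide.ThetaDistDatum.distBar_coinvRep · HodgeCM.Model.ThetaAdelicSide.ThetaDistDatum.clsU_distU_mem_block · HodgeCM.Model.ThetaAdelicSide.ThetaDistDatum.exists_mem_holSatU_clsU_mem_block) (`HOME/mc/pub-hodgecm-mc-sinst-1-g10/stage65/HodgeCM/Model/AdelicThetaDistributionBlock.lean`, md5 1535d9f21ed7, 151 lines);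
landed by the gen-27 packager (p-g27) in gate run 65 as `HodgeCM/Model/AdelicThetaDistributionBlock.lean` (verbatim).
-/
/-
Copyright (c) 2026 the pub-hodgecm formalisation cell (harness21).  New file, not vendored.
Origin: session prover-pub-hodgecm-mc-sinst-1-g10-0 (unit pub-hodgecm-mc-sinst-1-g10, S-INSTANCE CONSTRUCTOR gen 10; the (J4) input of the
(J-Liu-Θ) junction behind E's row 9 `hΘ`: the theta distribution factors through the central coinvariants `Ω(χ)` of the slot's finite
Weil factor and its tower classes lie in the block of `Ω(χ)`), 2026-08-20.
Intended final place: `HodgeCM/Model/AdelicThetaDistributionBlock.lean` (NEW additive model-layer leaf; imports sinst-1's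
`HodgeCM.Model.AdelicThetaDistributionSat` and `HodgeCM.Model.AdelicThetaTowerBlock` (#1244); nothing imports it; drop alone).
-/
import Summits.HodgeConjecture.HodgeCM.Model.AdelicThetaDistributionSat_2
import Summits.HodgeConjecture.HodgeCM.Model.AdelicThetaTowerBlock

set_option autoImplicit false

/-!
# The theta distribution through the coinvariants `Ω(χ)` of the slot's finite Weil factor; block membership of its tower classes

For a product Weil datum `D : S.ThetaDistDatum hV k` and a character `χ` of `[U(W)]` with `charInv χ ∈ 𝓕`:
* `D.ωfV` / `D.ωfW` — the two members of the finite factor (commuting, `commute_ωfV_ωfW`);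
* **`D.coinvRep χ : Representation ℂ U(V)(𝔸_f) (TwistedCoinv.Coinv D.ωfW (D.chiFin χ))`** — LIU'S MODULE OF THE SLOT at `χ`: the
  `χ(toIdele ·)⁻¹`-coinvariants of the finite Weil factor under the finite torus, with the `U(V)(𝔸_f)`-action (theta-3's generic `TwistedCoinv.rep`
  of #S14 at the finite factor `ωf` of THIS slot — scalar see-saw characters included, so it is the twist of `WeilCoinv.weilCoinv … ∘ ιV` by the
  slot's `U(V)(𝔸_f)`-character, [Liu21, (4.2)]);
* **`D.distBar … : TwistedCoinv.Coinv D.ωfW (D.chiFin χ) →ₗ[ℂ] S.holSatU hV k 𝓕`** — the distribution FACTORED through `Ω(χ)` (`TwistedCoinv.lift`,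
  hypothesis = `distU_ωf_W`), an INTERTWINER `coinvRep χ → holSatRep` (`distBar_coinvRep`, from `distU_ωf_V`), `range distBar = range distU`;
* **`clsU_distU_mem_block`**: every tower class `clsU (distU Φ_f)` lies in `⨆ ψ : (coinvRep χ).asModule →ₗ[ℂ[U(V)(𝔸_f)]] Tower, range ψ` — the
  `block` of the (J3) dictionary at the module `Ω(χ)` (#1244 `clsU_mem_iSup_range_of_equivariant`); `map_clsU_range_distU_le_block` for the
  whole range.  This is `hfam`'s second clause (binder-1 #R115 `subset_span_of_tower`) for the theta forms `θ(Φarch(·) ⊗ Φ_f, charInv χ)` of the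
  slot — ALL finite test vectors `Φ_f`, the STANDARD archimedean vector; the passage to an arbitrary archimedean vector of the `K_∞`-type is
  (J4-mult1) (Howe 1989 (3.13), a CITE candidate), not claimed here.
KERNEL only: 0 records, 0 `def … : Prop`, nothing cited as a sentence; `#print axioms` ⊆ {propext, Classical.choice, Quot.sound}.
-/

noncomputable section

open MeasureTheory MulAction IsDedekindDomain NumberField.mixedEmbedding Filter Topology
open NumberField hiding relNormOneIdeles relNormOneRat probHaarRelNormOneQuot
open Literature.NumberTheory.Automorphic Literature.NumberTheory.Weil1964
open Literature.Geometry.ComplexHyperbolic.BallModel (U21 x₀)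
open Literature.AlgebraicGeometry.HodgeTheory Literature.AlgebraicGeometry.ShimuraVarieties
open Literature.NumberTheory.Automorphic.PicardCM
open Literature.NumberTheory.Transcendental (Arapura2012_Cor_15_4_6)
open HodgeCM.Model.SupplyInstance HodgeCM.Model.SupplyResidual HodgeCM.Model.ThetaSpace HodgeCM.Model.TowerCarrier
open HodgeCM.Model.SupplyResidual.WeilPairData (charInv)
open scoped SchwartzMap TensorProduct Classical

namespace HodgeCM
namespace Model
namespace ThetaAdelicSide
namespace ThetaDistDatum

variable {L : CMField} {ι₁ : L →+* ℂ} {V : HermSpace3 L ι₁} {c : SeesawCtx L}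
variable {S : ThetaAdelicSide V c} {hV : IsAnisotropic L V.Hm} {k : Fin 4} (D : S.ThetaDistDatum hV k)

/-! ### § 1. The two members of the finite factor and Liu's module `Ω(χ)` of the slot -/

/-- the finite factor on `U(V)(𝔸_f)`. -/
def ωfV : Representation ℂ ↥V.adelicFin (FinSB (↥(maximalRealSubfield L)) (Fin 3)) := D.ωf.comp (MonoidHom.inl _ _)

/-- the finite factor on the finite torus. -/
def ωfW : Representation ℂ D.Uf (FinSB (↥(maximalRealSubfield L)) (Fin 3)) := D.ωf.comp (MonoidHom.inr _ _)

/-- (Ported verbatim from the HodgeCMPerL package; no docstring in the source.) -/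
@[simp] theorem ωfV_apply (g : V.adelicFin) : D.ωfV g = D.ωf (g, 1) := rfl

/-- (Ported verbatim from the HodgeCMPerL package; no docstring in the source.) -/
@[simp] theorem ωfW_apply (u : D.Uf) : D.ωfW u = D.ωf (1, u) := rfl

/-- The two members commute (they commute in the product group). -/
theorem commute_ωfV_ωfW (g : V.adelicFin) (u : D.Uf) : Commute (D.ωfV g) (D.ωfW u) := by
  change D.ωf (g, 1) * D.ωf (1, u) = D.ωf (1, u) * D.ωf (g, 1)
  rw [← map_mul, ← map_mul, Prod.mk_mul_mk, Prod.mk_mul_mk, mul_one, one_mul, mul_one, one_mul]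

/-- **Liu's module of the slot at `χ`**: the `χ(toIdele ·)⁻¹`-coinvariants of the finite Weil factor under the finite torus, as a representation of
`U(V)(𝔸_f)`. -/
def coinvRep (χ : PontryaginDual (↥(relNormOneIdeles (↥(maximalRealSubfield L)) L) ⧸ relNormOneRat (↥(maximalRealSubfield L)) L)) :
    Representation ℂ ↥V.adelicFin (TwistedCoinv.Coinv D.ωfW (D.chiFin χ)) :=
  TwistedCoinv.rep (D.chiFin χ) D.ωfV D.commute_ωfV_ωfW

/-- (Ported verbatim from the HodgeCMPerL package; no docstring in the source.) -/
theorem coinvRep_mk (χ : PontryaginDual (↥(relNormOneIdeles (↥(maximalRealSubfield L)) L) ⧸ relNormOneRat (↥(maximalRealSubfield L)) L))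
    (g : V.adelicFin) (Φf : FinSB (↥(maximalRealSubfield L)) (Fin 3)) :
    D.coinvRep χ g (TwistedCoinv.mk D.ωfW (D.chiFin χ) Φf) = TwistedCoinv.mk D.ωfW (D.chiFin χ) (D.ωf (g, 1) Φf) := rfl

/-! ### § 2. The factored distribution -/

section Bar

variable (hHD : exists_isReal_hodgeModel) (hI : hodgePQ_independent_of_hodgeModel)
  (h₁ : BallQuotientUniformised) (h₃ : CMAbelianVarietyRealised) (hA : Arapura2012_Cor_15_4_6)
variable (hGfin : ∀ K : Subgroup ↥V.adelicFin, satG hV K ≤ S.Gfin) (hLF : (S.P k).IsLFAction)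
  (hd : ∀ (T : 𝓢((Fin 3 → mixedSpace (↥(maximalRealSubfield L))), ℂ) →L[ℂ] ℂ) (ℓ : Module.Dual ℂ (Fin 2 → ℂ)),
    DifferentiableAt ℝ (fun b => T (D.ωA (BallForms.expP b) (D.Φarch ℓ))) 0)
  (hCR : ∀ (T : 𝓢((Fin 3 → mixedSpace (↥(maximalRealSubfield L))), ℂ) →L[ℂ] ℂ) (ℓ : Module.Dual ℂ (Fin 2 → ℂ)) (v : Fin 2 → ℂ),
    fderiv ℝ (fun b => T (D.ωA (BallForms.expP b) (D.Φarch ℓ))) 0 (Complex.I • v) =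
      Complex.I • fderiv ℝ (fun b => T (D.ωA (BallForms.expP b) (D.Φarch ℓ))) 0 v)
  {𝓕 : Set C(↥(relNormOneIdeles (↥(maximalRealSubfield L)) L) ⧸ relNormOneRat (↥(maximalRealSubfield L)) L, ℂ)}
  (χ : PontryaginDual (↥(relNormOneIdeles (↥(maximalRealSubfield L)) L) ⧸ relNormOneRat (↥(maximalRealSubfield L)) L))
  (hχ : charInv χ ∈ 𝓕)

/-- **The distribution factored through `Ω(χ)`** (`TwistedCoinv.lift` with the `χ`-variance `distU_ωf_W`). -/
def distBar : TwistedCoinv.Coinv D.ωfW (D.chiFin χ) →ₗ[ℂ] S.holSatU hV k 𝓕 :=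
  TwistedCoinv.lift D.ωfW (D.chiFin χ) (D.distU hGfin hLF hd hCR hχ) fun u Φf => D.distU_ωf_W hGfin hLF hd hCR χ hχ u Φf

/-- (Ported verbatim from the HodgeCMPerL package; no docstring in the source.) -/
@[simp] theorem distBar_mk (Φf : FinSB (↥(maximalRealSubfield L)) (Fin 3)) :
    D.distBar hGfin hLF hd hCR χ hχ (TwistedCoinv.mk D.ωfW (D.chiFin χ) Φf) = D.distU hGfin hLF hd hCR hχ Φf := rfl

/-- `range distBar = range distU`. -/
theorem range_distBar : LinearMap.range (D.distBar hGfin hLF hd hCR χ hχ) = LinearMap.range (D.distU hGfin hLF hd hCR hχ) :=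
  TwistedCoinv.range_lift _ _ _ _

/-- **`distBar` intertwines `Ω(χ)` with right translation on `holSatU`.** -/
theorem distBar_coinvRep (g : V.adelicFin) (x : TwistedCoinv.Coinv D.ωfW (D.chiFin χ)) :
    D.distBar hGfin hLF hd hCR χ hχ (D.coinvRep χ g x) = S.holSatRep hV k 𝓕 g (D.distBar hGfin hLF hd hCR χ hχ x) :=
  TwistedCoinv.lift_rep (D.chiFin χ) D.ωfV D.commute_ωfV_ωfW _ _ (S.holSatRep hV k 𝓕)
    (fun g Φf => D.distU_ωf_V hGfin hLF hd hCR hχ g Φf) g x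

/-! ### § 3. Block membership of the tower classes -/

/-- **BLOCK MEMBERSHIP**: for every finite test vector `Φ_f`, the tower class of `θ(Φarch(·) ⊗ Φ_f, charInv χ)` lies in
`⨆ ψ : Ω(χ) →ₗ[ℂ[U(V)(𝔸_f)]] Tower, range ψ` (honest archimedean component `hι`). -/
theorem clsU_distU_mem_block (hι : S.ιinf = archInfOf V) (Φf : FinSB (↥(maximalRealSubfield L)) (Fin 3)) :
    S.clsU hHD hI h₁ h₃ hA 𝓕 hι hV k (D.distU hGfin hLF hd hCR hχ Φf) ∈
      ⨆ ψ : (D.coinvRep χ).asModule →ₗ[MonoidAlgebra ℂ ↥V.adelicFin] Tower hHD hI (ballQuotientUniformisedDatum_of h₁) h₃ hA V,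
        (LinearMap.range ψ).restrictScalars ℂ := by
  rw [← distBar_mk]
  exact S.clsU_mem_iSup_range_of_equivariant hHD hI h₁ h₃ hA hι hV k (D.coinvRep χ) (D.distBar hGfin hLF hd hCR χ hχ)
    (D.distBar_coinvRep hGfin hLF hd hCR χ hχ) _

/-- The same for the whole range of the distribution: `clsU '' (range distU) ⊆ block(Ω(χ))`. -/
theorem map_clsU_range_distU_le_block (hι : S.ιinf = archInfOf V) :
    (LinearMap.range (D.distU hGfin hLF hd hCR hχ)).map (S.clsU hHD hI h₁ h₃ hA 𝓕 hι hV k) ≤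
      ⨆ ψ : (D.coinvRep χ).asModule →ₗ[MonoidAlgebra ℂ ↥V.adelicFin] Tower hHD hI (ballQuotientUniformisedDatum_of h₁) h₃ hA V,
        (LinearMap.range ψ).restrictScalars ℂ := by
  rintro _ ⟨_, ⟨Φf, rfl⟩, rfl⟩
  exact D.clsU_distU_mem_block hHD hI h₁ h₃ hA hGfin hLF hd hCR χ hχ hι Φf

include hGfin hLF hd hCR hχ in
/-- **The theta form of the slot at `(Φ_f, charInv χ)` as a function, its tower class, and where it lives** — the (J4) input of `hfam` in one
statement: `dist (charInv χ) Φ_f ∈ holSatU` and `clsU ⟨dist (charInv χ) Φ_f, _⟩ ∈ block(Ω(χ))`. -/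
theorem exists_mem_holSatU_clsU_mem_block (hι : S.ιinf = archInfOf V) (Φf : FinSB (↥(maximalRealSubfield L)) (Fin 3)) :
    ∃ hF : D.dist (charInv χ) Φf ∈ S.holSatU hV k 𝓕,
      S.clsU hHD hI h₁ h₃ hA 𝓕 hι hV k ⟨D.dist (charInv χ) Φf, hF⟩ ∈
        ⨆ ψ : (D.coinvRep χ).asModule →ₗ[MonoidAlgebra ℂ ↥V.adelicFin] Tower hHD hI (ballQuotientUniformisedDatum_of h₁) h₃ hA V,
          (LinearMap.range ψ).restrictScalars ℂ :=
  ⟨D.dist_mem_holSatU hGfin hLF hd hCR hχ Φf, D.clsU_distU_mem_block hHD hI h₁ h₃ hA hGfin hLF hd hCR χ hχ hι Φf⟩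

end Bar

end ThetaDistDatum
end ThetaAdelicSide
end Model
end HodgeCM

end
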